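import Summits.QuantumFields.YangMills.Theorems.BalabanUVNodesN22GenAnalyticReadingOfActivities
import Summits.QuantumFields.YangMills.Theorems.BalabanUVNodesN10GenAnalyticReadingOfTermwise226
import Summits.QuantumFields.YangMills.Theorems.BalabanUVNodesN10OlderTermsBanachSectionAtTableGerms

/-!
# BalabanUVNodes ∕ node N22 = NE9 — THE N10 → N22 JUNCTION: ROAD 2 at the record for def-W1's (2.14) TERM DATA `(𝔇 K).Gn` with the older terms READ ON
# NODE N10's TABLE-GERM CARRIER (`B13OlderTermsTableGerms.Pot ∕ ρ ∕ cv`) — module J66 §2's whole older-term reading block (`hHA hAh hmaj hAdmr hρ₁ hρ₂`)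
# and (Adm-run) DISCHARGED BY NAME from N10's modules 102 §4 ∕ 105 ∕ 106 and def-W1's `RecAdmissible`; the residual older-term input is ONE displayed
# row per term: holomorphy ∧ the (2.26) weight of the (2.14) term along the canonical section on the `Pot`-ball (N10's INTENT-8 output shape)

Cell `pub-ymgap`, HUMAN RULING D-0062 (Track A), R134 seat `pub-ymgap-dag-n22-c` (strategy s1: «the history-Lipschitz estimate (2.40)–(2.41) p. 21 of [II] on the W1 object»), generation
19, module J68.  THEOREMS ONLY (no `def`, no `sorry`, standard axioms); `--kind proof --supports stmt-QuantumFields-27366 --as helper` (K3⁸ `SpineGivenEndpointR13SepCoPHV`), COUNT-NEUTRAL.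
Imports this lane's module J66 `…N22GenAnalyticReadingOfActivities` (ROAD 2 non-expansive at the record from an analytic reading of the ACTIVITIES) and node N10's (seat `pub-ymgap-dag-n10-c`
g19) modules 102 `…N10GenAnalyticReadingOfTermwise226` (v1.1 §4 `activityReading_termData_of_termwise226`) and 106 `…N10OlderTermsBanachSectionAtTableGerms` (`𝒱_tableGerms_reading`,
`norm_ρ_tableGerms_le ∕ _sub_le ∕ _threePoint_le`; through it the Literature carrier `B13OlderTermsTableGerms`, module 105, and def-W1's `Node00.HistoryTermDatum214*` storeys).  Nothing
re-declared; every N10 ∕ def-W1 name is consumed BY NAME.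

WHY (interface row IR-N22-AR, consumer side; dag-lead DEDUP-408's ask).  Module J66 §2 reduced K3's `h9` on ROAD 2 to an ANALYTIC READING OF THE ACTIVITIES of a generator tower:
readings `ρA K k : OlderTerms → Pot K k` into Banach spaces with (AR-adm)∕(AR-dom₁)∕(AR-dom₂), read activities `Ah` with (ARH-fact) on an admissibility class, (ARH-holo) and
the (2.38)-majorant on `ball 0 R`, (Adm-run) along the window's histories — all DISPLAYED.  Node N10 has since TYPED THE CARRIER: at def-W1's (2.14) term data
`𝔇 K : TermData214 c₀ (F.P K) 𝔸 M L` (`(𝔇 K).Gn = GenTower.ofTerms L (𝔇 K).TF`, the history entering each term ONLY through Lemma 2's potentials `𝒱`), the older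
terms of the admissible class `W1.AdmHist (sp K) E₀ r₁ k` ([I] (1.18) + analyticity on the tables) are read into the Banach space `Pot k (sp K)` of bounded tables with
table-analytic germs (weighted sup norm, level weights `aw K k j`, rate `κ_E`) by `ρ (sp K) κ_E (aw K k ·)`, with the canonical linear section `cv κ_E (aw K k ·)`
reproducing the germs of admissible histories (module 105); module 106 proves (AR-adm)∕(AR-dom₁)∕(AR-dom₂) for THIS reading and, from def-W1's unscaled-field law +
«the older-terms potential is read by atoms mapping the tables into the tables», that the potentials of `cv (ρ old)` and `old` AGREE (`𝒱_tableGerms_reading`); module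
102 §4 turns that agreement + per-term holomorphy-and-(2.26) along `cv` on the ball into J66 §2's activity triple (Lemma 3's resummation on the torus, `Φ := Pot`).  THIS FILE
COMPOSES THEM: every older-term READING binder of J66 §2 disappears, (Adm-run) is def-W1's `RecAdmissible (𝔇 K).Gn (D K) (AdmHist (sp K) E₀ r₁)` on a coupling domain
containing the window, and what is left of the older-term input is, per term `s ∈ terms L M Z` of every `Z ⊆ X`, the ONE row
  `hT`: `DifferentiableOn ℂ (p ↦ (𝔇 K k).TF Z s t (cv p) φ) (ball 0 R) ∧ ∀ p ∈ ball 0 R, ‖(𝔇 K k).TF Z s t (cv p) φ‖ ≤ weight L M c Z a s · e^{a₅|Z|}`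
— [II] (2.15)–(2.26) for the (2.14) term with the older terms moved holomorphically through the section (EXACTLY the output shape of N10's `B13TermDatum214ParamHolo.h226T_of_inputs226Holo`
fed by module 106, announced as N10's INTENT-8 `termReading226_tableGerms_of_inputs226Holo`; displayed here, `exact`ed there when it lands).
* §1 ★★★ `ne9_EA_objectsOfRecord₁₃_of_kernelStepRate_termDataTableGermsNonexpansive` — K3's `h9` = J66 §2 at `Gn K := (𝔇 K).Gn`, `Pot K k := Pot k (sp K)`,
  `ρA K k := ρ (sp K) κ_E (aw K k ·)`, `Adm K k := (· ∈ AdmHist (sp K) E₀ r₁ k)`, `Ah K k t φ Z p := Σ_{s ∈ terms L M Z} (𝔇 K k).TF Z s t (cv p) φ`, with `hHA hAh hmaj` :=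
  N10 102 §4 (`A_a = C₃ε₁`, `R_a = (1−8δ)½Lκ`), `hAdmr hρ₁ hρ₂` := N10 106 §2 (`r₀ = c_w·E₀`), `hAdm` := `RecAdmissible` + `]0,γ] ⊆ D K`; the reading section `hcv`
  (potentials of `cv (ρ old)` and `old` agree on the class) and `hT` displayed.
* §2 ★★★ `ne9_EA_objectsOfRecord₁₃_of_kernelStepRate_termDataTableGermsLawsNonexpansive` — §1 with `hcv` DISCHARGED by N10 106 `𝒱_tableGerms_reading` from def-W1's laws:
  the family unscaled-field law `(𝔇 K).UnscaledFieldLawOn χu χcu 𝒲 𝒪 γ` ([I] (2.9)–(2.13)), `ReadsBy` (the older-terms potential is read by atoms `Rd K k Z t`, [II] (1.41)),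
  `MapsToTables` on configuration windows `W K k Z t ⊇ sp K (k+1) X` (`Z ⊆ X`), open tables at every level, positive bounded level weights, `κ_E ≤ r₁`.
* §3 ★★★ socket `n22At_u3OfRecord₁₃_of_kernelStepRate_termDataTableGermsLawsNonexpansive` — §2 ⟹ `N22At (u3OfRecord₁₃ θ (objectsOfRecord₁₃ F N θ ℓ) k)` for every run
  length `k` (dag-n27-c's `h22` row; plug = J67's leaf shape with `Gn ↦ (𝔇 ·).Gn`, the reading block replaced by `hsp hE₀ hRA hD χu χcu 𝒲 𝒪 Rd W hlaw hread hmaps hW … hT`,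
  `hawpos` for `haw`, `hR : c_w·E₀ + ϱ < R`).
THE LEVEL-`0` DEVICE (A6, non-degeneracy of the law block).  J66's (AR-dom₁∕₂) rows dominate the reading's differences by the levels `k′+1` only, while N10's sup norm
weighs EVERY level `j ≤ k` positively; N10's Summit-side `_succ` rows bridge this with an EMPTY level-`0` table `sp K 0 Y = ∅` — but then def-W1's reading law
`MapsToTables (sp K) W univ` at a level-`0` atom forces the atoms' parameter space to be empty as soon as the window `W` is inhabited, i.e. `𝒪 ≡ 0` under `ReadsBy`
(a history-free datum).  This file does NOT take that route: the admissibility class handed to J66 is `old ∈ AdmHist (sp K) E₀ r₁ k ∧ old 0 = 0` — def-W1's run has NO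
level-`0` term (`recTerm_zero`, [I] (0.23)), so (Adm-run) still follows from `RecAdmissible` — and on that class the level-`0` entries of every difference vanish, so N10's
ALL-LEVEL rows `B13OlderTermsTableGerms.norm_ρ_sub_ρ_le ∕ norm_ρ_threePoint_le` (module 105, no empty-table clause) serve J66's rows; the level-`0` table `sp K 0` stays
free (e.g. `univ`), and the law block of §2 is inhabited by history-READING data.

After J68 the older-term input of N22's ROAD 2 (recursion currency, non-expansive regime, def-W1's term data) is: def-W1's LAWS (unscaled-field law, reading atoms into the
tables), def-W1's admissibility bookkeeping `RecAdmissible`, and PER TERM the row `hT` (N10's INTENT-8); unchanged: N18's kernel step rate, the last-coupling sectors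
`hholS ∕ hbdS` of `((𝔇 K).Gn k).E`, S25's located configuration-chart block (`Ec ι Φ U …`, `hEhol`), readings ∕ tails ∕ law ∕ (1.21), `Lemma3Numerics` + the two [KP86] clauses +
the renewal, the standing rows (`ℓ.θ₅ ≤ ℓ.ω²`, `4M_b c_w∕ϱ < 1`, `hC₉`).

HONEST FRAMING (binding).  Count-neutral COMPOSITION of tree theorems BY NAME (J66 §2; N10 102 §4 ∕ 106; def-W1's `RecAdmissible` unfolded); `hT`, the laws, the reading
atoms, the admissibility bookkeeping, the numerics and every other binder are DISPLAYED HYPOTHESES (GAPS G-ne9p2-5 now sit in `hT` at the term level and in def-W1's laws;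
N10's INTENT-8 will locate `hT` on ONE record of (2.26) inputs per term + (2.20) at one admissible history); NO estimate of Bałaban's is proved or asserted; nothing of the
record is constructed or claimed to meet the displayed inputs.  N10 and N22 are NOT discharged (typed 28∕28 · discharged 5∕27 UNCHANGED); K3⁸ ∕ K1⁹ OPEN and NOT claimed;
NE9 is NOT IN PRINT for d = 4; no count claim; one finite 𝕋⁴ programme at fixed ε — R4 closes the CONDITIONAL rung `BalabanLadder.UV` only; NOTHING about the continuum limit,
ℝ⁴, infinite volume, OS axioms, a mass gap or the Clay problem is proved or claimed.  References (TYPES only): [II] = Bałaban, CMP 116 (1988) (1.41) p. 11, (2.9)–(2.15)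
pp. 14–15, (2.20) p. 16, (2.26) p. 17, Lemma 3 (2.38) p. 20, (2.39)–(2.41) p. 21; [I] = CMP 109 (1987) (1.18) p. 263, (2.9)–(2.13) pp. 266–268; Kotecký–Preiss, CMP 103 (1986)
Thm p. 492; King, CMP 102 (1986) Lemma 4.5 (4.38).
-/

noncomputable section

open Set Metric
open scoped BigOperators

namespace YMDAG.N22.KernelFading

open Literature.MathematicalPhysics.QuantumFieldTheory.Balaban1983to89
open Literature.MathematicalPhysics.QuantumFieldTheory.Balaban1983to89.T4Continuum (T4Family ULoop)
open Literature.MathematicalPhysics.QuantumFieldTheory.Balaban1983to89.T4OutputRate (Window NE9)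
open Literature.MathematicalPhysics.QuantumFieldTheory.Balaban1983to89.TreeLengthTorus (TPt TDom tsys torusTreeLen)
open Literature.MathematicalPhysics.QuantumFieldTheory.Balaban1983to89.B12TreeDecay (K₀ kappa₀)
open Literature.MathematicalPhysics.QuantumFieldTheory.Balaban1983to89.B12Decay510 (delta1)
open Literature.MathematicalPhysics.QuantumFieldTheory.Balaban1983to89.B12Decay510Window (K₁)
open Literature.MathematicalPhysics.QuantumFieldTheory.Balaban1983to89.B12Decay510Torus (distCT nearT)
open Literature.MathematicalPhysics.QuantumFieldTheory.Balaban1983to89.B13Lemma3TorusData (TBond)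
open Literature.MathematicalPhysics.QuantumFieldTheory.Balaban1983to89.B13Lemma3TorusTerms (terms weight)
open Literature.MathematicalPhysics.QuantumFieldTheory.Balaban1983to89.B13Lemma3TorusSocket (Lemma3Numerics)
open Literature.MathematicalPhysics.QuantumFieldTheory.Balaban1983to89.B13OlderTermsTableGerms (Pot cv ρ norm_ρ_le_of_admHist norm_ρ_sub_ρ_le
  norm_ρ_threePoint_le)
open Literature.MathematicalPhysics.QuantumFieldTheory.Balaban1983to89.Node00 (Stage13Params Stage13HParams U3Letters₁₁ MatA)
open Literature.MathematicalPhysics.QuantumFieldTheory.Balaban1983to89.Node00.Sect2 (domSys domCount CPair)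
open Literature.MathematicalPhysics.QuantumFieldTheory.Balaban1983to89.Node00.W1
open Literature.MathematicalPhysics.QuantumFieldTheory.Balaban1983to89.Node00.LocalizedSum17 (ReadingMaps Localizes17OfRecord₁₃)
open Literature.MathematicalPhysics.QuantumFieldTheory.Balaban1983to89.Node00.U3OfKernels (histPrefix objectsOfRecord₁₃)
open Literature.MathematicalPhysics.QuantumFieldTheory.Balaban1983to89.Node00.U3KernelLetters (KernelStepRateOfRecord₁₃ PolLimitsExistOfRecord₁₃)
open YMDAG.UVSplit (N22At u3OfRecord₁₃ RateReading₁₃CoPH rateCarriersOfRecord₁₃CoPH)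
open YMDAG.N22.AtKernels (n22At_u3OfRecord₁₃_objectsOfRecord₁₃_iff)
open YMDAG.N10 (activityReading_termData_of_termwise226 𝒱_tableGerms_reading)

open scoped Matrix.Norms.L2Operator

variable (F : T4Family) (N : ℕ) [NeZero N] {𝔸 : Type} [NormedRing 𝔸] [NormedAlgebra ℂ 𝔸]

/-! ## §1 ★★★ K3's `h9` on ROAD 2 for def-W1's term data read on the table-germ carrier — the reading block discharged by N10 -/

open Classical Finset in
/-- ★★★ **K3's `h9` ON ROAD 2 FOR def-W1's (2.14) TERM DATA WITH THE OLDER TERMS READ ON N10's TABLE-GERM CARRIER — module J66 §2 with its older-term reading block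
`hHA hAh hmaj hAdmr hρ₁ hρ₂` and (Adm-run) DISCHARGED BY NAME** (N10 102 §4 `activityReading_termData_of_termwise226`: Lemma 3's resummation of per-term (2.26) along the
section, `A_a = C₃ε₁`, `R_a = (1−8δ)½Lκ`; N10 106 §2: (AR-adm) `‖ρ old‖ ≤ c_w E₀`, (AR-dom₁), (AR-dom₂) for the table-germ reading; def-W1 `RecAdmissible (𝔇 K).Gn (D K)
(AdmHist (sp K) E₀ r₁)` with `]0, γ] ⊆ D K` and the run's vanishing level-`0` term `recTerm_zero` — J66's class here is `AdmHist ∧ (old 0 = 0)`, on which module 105's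
ALL-LEVEL domination rows serve J66's level-`k′+1` rows).  Older-term inputs left: the reading section `hcv` (Lemma 2's potentials of `cv (ρ old)` and of `old` agree for admissible
`old` — §2 discharges it from the laws) and, per term, `hT` (holomorphy ∧ the (2.26) weight of `p ↦ (𝔇 K k).TF Z s t (cv p) φ` on `ball 0 R`); level weights
`0 < aw K k j ≤ c_w`, open tables `sp K j` (every level), `κ ≤ κ_E ≤ r₁`, `0 ≤ E₀`, `c_w E₀ + ϱ < R`, `4M_b c_w∕ϱ < 1`; + N18, last-coupling sectors, S25's block,
readings ∕ law ∕ (1.21), standing rows ⟹ **`NE9 ((objectsOfRecord₁₃ F N θ ℓ).EA 0) (Window θ.γ) ℓ.κ ℓ.moduli`**.  LOCATED (hypothesis form; GAPS G-ne9p2-5 in `hT`); N22 NOT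
discharged. [folklore] -/
theorem ne9_EA_objectsOfRecord₁₃_of_kernelStepRate_termDataTableGermsNonexpansive (θ : Stage13Params F N) (ℓ : U3Letters₁₁) (hs : ℓ.Signs) (hγ : 0 < θ.γ)
    (hlim : PolLimitsExistOfRecord₁₃ F N θ) {κ₅ C₅ : ℝ} (hC₅ : 0 ≤ C₅) (h5 : KernelStepRateOfRecord₁₃ F N θ κ₅ ℓ.θ₅ C₅)
    (m' : ℕ) (M : ℕ) [NeZero M] (hM : M = F.L ^ m')
    {c₀ : B13.Consts} {L : ℕ} [NeZero L] (𝔇 : (K : ℕ) → TermData214 c₀ (F.P K) 𝔸 M L) (emb : ReadingMaps F (MatA N) 𝔸)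
    (hloc : Localizes17OfRecord₁₃ F N θ (fun K => truncRun K (toClusterTower (𝔇 K).Gn)) emb)
    (sp : (K j : ℕ) → (domSys (F.P K) M j).Dom → Set (CPair (F.P K) 𝔸))
    (hsp : ∀ (K j : ℕ) (Y : (domSys (F.P K) M j).Dom), IsOpen (sp K j Y))
    {κ κE δ₀ B₃ r R E₀ ϱ Mb cw cS Bq r₁ : ℝ} {aw : ℕ → ℕ → ℕ → ℝ}
    (hκ₀ : kappa₀ (4 * 2 ^ 4) (2 * 4) ≤ κ / 2) (hδ₀ : 0 < δ₀) (hB₃ : 0 ≤ B₃) (hr : 0 < r) (hκE : κ ≤ κE) (hE₀ : 0 ≤ E₀)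
    {D : ℕ → Set ℂ} (hRA : ∀ K, RecAdmissible (𝔇 K).Gn (D K) (AdmHist (sp K) E₀ r₁))
    (hD : ∀ K, ∀ t ∈ Ioc (0 : ℝ) θ.γ, ((t : ℝ) : ℂ) ∈ D K)
    (hcv : ∀ (K k : ℕ), ∀ t ∈ Ioc (0 : ℝ) θ.γ, ∀ (old : OlderTerms (F.P K) 𝔸 M k), old ∈ AdmHist (sp K) E₀ r₁ k →
      ∀ (X : (domSys (F.P K) M (k + 1)).Dom), ∀ φ ∈ sp K (k + 1) X, ∀ Z : (domSys (F.P K) M (k + 1)).Dom, Subtype.val Z ⊆ Subtype.val X → ∀ s ∈ terms L M Z,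
        ∀ Y B, (𝔇 K k).𝒱 Z s ((t : ℝ) : ℂ) (cv κE (fun j : Fin (k + 1) => aw K k j) (ρ (sp K) κE (fun j : Fin (k + 1) => aw K k j) old)) φ Y B =
          (𝔇 K k).𝒱 Z s ((t : ℝ) : ℂ) old φ Y B)
    (c : B13.Consts) (hL : 8 ≤ c.L) (hLc : c.L = L) {a a₂ a₂' a₅ Aabs : ℝ} (hN : Lemma3Numerics c M ((c.L : ℝ) / 2) a a₂ a₂' a₅ Aabs)
    (hT : ∀ (K k : ℕ), ∀ t ∈ Ioc (0 : ℝ) θ.γ, ∀ (X : (domSys (F.P K) M (k + 1)).Dom), ∀ φ ∈ sp K (k + 1) X,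
      ∀ Z : (domSys (F.P K) M (k + 1)).Dom, Subtype.val Z ⊆ Subtype.val X → ∀ s ∈ terms L M Z,
        DifferentiableOn ℂ (fun p : Pot k (sp K) => (𝔇 K k).TF Z s ((t : ℝ) : ℂ) (cv κE (fun j : Fin (k + 1) => aw K k j) p) φ) (ball 0 R) ∧
          ∀ p ∈ ball (0 : Pot k (sp K)) R,
            ‖(𝔇 K k).TF Z s ((t : ℝ) : ℂ) (cv κE (fun j : Fin (k + 1) => aw K k j) p) φ‖ ≤ weight L M c Z a s * Real.exp (a₅ * ((Z.1).card : ℝ)))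
    (hA0 : 0 ≤ c.C3act * c.ε₁) (hr₁ : 0 ≤ r₁) (hrate : r₁ + 2 * (64 * Real.log 162) + 2 ≤ (1 - 8 * c.δ) * ((c.L : ℝ) / 2) * c.κ)
    (hsmall : c.C3act * c.ε₁ * Real.exp (5 * r₁ + 1) * K₀ 64 8 * 9 * 64 ≤ 1) (hκr : κE ≤ r₁) (hrenew : Real.exp 1 * 9 * 64 * K₀ 64 8 ^ 2 * (c.C3act * c.ε₁) ≤ Mb)
    (hawpos : ∀ K k j, 0 < aw K k j) (hawcw : ∀ K k j, aw K k j ≤ cw) (hC1 : 4 * Mb * cw / ϱ < 1)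
    (hMb0 : 0 ≤ Mb) (hϱ : 0 < ϱ) (hR : cw * E₀ + ϱ < R)
    (O : ℕ → Set ℂ) (V : (K k : ℕ) → OlderTerms (F.P K) 𝔸 M k → CPair (F.P K) 𝔸 → (domSys (F.P K) M (k + 1)).Dom → ℂ) (hcS : 0 < cS) (hBq : 0 ≤ Bq)
    (hballS : ∀ K, ∀ s ∈ Ioc (0 : ℝ) θ.γ, closedBall (s : ℂ) (cS * s) ⊆ O K)
    (hholS : ∀ (K k : ℕ) (old : OlderTerms (F.P K) 𝔸 M k), old ∈ AdmHist (sp K) E₀ r₁ k ∧ old 0 = 0 → ∀ (X : (domSys (F.P K) M (k + 1)).Dom), ∀ φ ∈ sp K (k + 1) X,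
      DifferentiableOn ℂ (fun z => ((𝔇 K).Gn k).E z old φ X) (O K))
    (hbdS : ∀ (K k : ℕ) (old : OlderTerms (F.P K) 𝔸 M k), old ∈ AdmHist (sp K) E₀ r₁ k ∧ old 0 = 0 → ∀ (X : (domSys (F.P K) M (k + 1)).Dom), ∀ φ ∈ sp K (k + 1) X,
      ∀ s ∈ Ioc (0 : ℝ) θ.γ, ∀ z ∈ closedBall (s : ℂ) (cS * s),
        ‖((𝔇 K).Gn k).E z old φ X - V K k old φ X‖ ≤ Bq * Real.exp (-(κE * (domSys (F.P K) M (k + 1)).dj X)) * s ^ 2)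
    (Ec : ℕ → ℕ → Type*) [∀ K k, NormedAddCommGroup (Ec K k)] [∀ K k, NormedSpace ℂ (Ec K k)]
    (ι : letI := θ.instVβ₁; letI := θ.instVβ₂
      (K k : ℕ) → (domSys (F.P K) M (k + 1)).Dom → ((Fin (F.P K).d → Site (F.P K) (k + 1) → θ.Vβ) →L[ℝ] Ec K k))
    (Φ : (K k : ℕ) → (domSys (F.P K) M (k + 1)).Dom → Ec K k → CPair (F.P K) 𝔸)
    (U : (K k : ℕ) → (domSys (F.P K) M (k + 1)).Dom → Set (Ec K k)) (hU : ∀ K k X, IsOpen (U K k X)) (hrU : ∀ K k X, ball (0 : Ec K k) r ⊆ U K k X)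
    (hEhol : ∀ g ∈ Window θ.γ, ∀ (K k : ℕ) (X : (domSys (F.P K) M (k + 1)).Dom),
      DifferentiableOn ℂ (fun z => (truncRun K (toClusterTower (𝔇 K).Gn) k).E (histPrefix g k) (Φ K k X z) X) (U K k X))
    (hΦemb : letI := θ.instVβ₁; letI := θ.instVβ₂
      ∀ (K k : ℕ) (X : (domSys (F.P K) M (k + 1)).Dom) (Bf : Fin (F.P K).d → Site (F.P K) (k + 1) → θ.Vβ),
        Φ K k X (ι K k X Bf) = emb K k (fun l t => NormedSpace.exp (θ.ρ8 (Bf l t))))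
    (hΦsp : ∀ (K k : ℕ) (X : (domSys (F.P K) M (k + 1)).Dom), ∀ z ∈ ball (0 : Ec K k) r, Φ K k X z ∈ sp K (k + 1) X)
    (w : (K k : ℕ) → (domSys (F.P K) M (k + 1)).Dom → Site (F.P K) (k + 1) → ℝ) (hw₀ : ∀ K k X t, 0 ≤ w K k X t)
    (hw : letI := θ.instVβ₁; letI := θ.instVβ₂; letI := θ.instιβ
      ∀ (K k : ℕ) (X : (domSys (F.P K) M (k + 1)).Dom) (l : Fin (F.P K).d) (t : Site (F.P K) (k + 1)) (c : θ.ιβ),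
        ‖ι K k X (Pi.single l (Pi.single t (θ.bV c)))‖ ≤ w K k X t)
    (htail : ∀ (K k : ℕ) (X : (domSys (F.P K) M (k + 1)).Dom) (t : Site (F.P K) (k + 1)),
      let e : Site (F.P K) (k + 1) → TPt 4 (domCount (F.P K) M (k + 1) * M) := fun x i => (ZMod.cast (x i) : ZMod (domCount (F.P K) M (k + 1) * M))
      w K k X t ≤ B₃ * Real.exp (-δ₀ * distCT (domCount (F.P K) M (k + 1)) M (e t) (nearT (M := M) (e t) X)))
    (hκ₅ : delta1 δ₀ κ ((M : ℝ) * 4) ≤ κ₅)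
    (hω : 0 < ℓ.ω) (hθω : ℓ.θ₅ ≤ ℓ.ω ^ 2) (hℓκ : ℓ.κ ≤ delta1 δ₀ κ ((M : ℝ) * 4))
    (hC₉ : (4 * (2 * C₅ / (1 - ℓ.θ₅) + 2 * ((16 * Mb * B₃ ^ 2 / r ^ 2) * Real.exp (delta1 δ₀ κ ((M : ℝ) * 4) * ((M : ℝ) * 4) * 3) * K₀ (4 * 2 ^ 4) (2 * 4) * K₁ 4 (δ₀ / 2))) / θ.γ +
        ((16 * max ((6 * cS ^ 2 + 32 * cS + 64) / cS ^ 2 * Bq) (64 * Mb * cw ^ 2 / ϱ ^ 2 * (Bq * θ.γ / cS) ^ 2 / (1 - 4 * Mb * cw / ϱ)) * B₃ ^ 2 / r ^ 2) * Real.exp (delta1 δ₀ κ ((M : ℝ) * 4) * ((M : ℝ) * 4) * 3) * K₀ (4 * 2 ^ 4) (2 * 4) *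
          K₁ 4 (δ₀ / 2)) * θ.γ / 2) / ℓ.ω ≤ ℓ.C₉) :
    NE9 ((objectsOfRecord₁₃ F N θ ℓ).EA 0) (Window θ.γ) ℓ.κ ℓ.moduli := by
  -- the admissibility class of this junction: def-W1's `AdmHist` AND a vanishing level-`0` slice (the run's level-`0` term is `0`, `recTerm_zero`, [I] (0.23))
  let Adm : (K k : ℕ) → OlderTerms (F.P K) 𝔸 M k → Prop := fun K k old => old ∈ AdmHist (sp K) E₀ r₁ k ∧ old 0 = 0
  have hAdm : ∀ K, ∀ g ∈ Window θ.γ, ∀ k, Adm K k (olderOf (recTerm (𝔇 K).Gn fun n => ((g n : ℝ) : ℂ)) k) := fun K g hg k =>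
    ⟨hRA K _ (fun n => hD K _ (hg n)) k, by funext X φ; simp [olderOf_apply, recTerm_zero]⟩
  -- N10 module 102 §4: the activity-level triple (H-fact) ∧ (H-holo) ∧ (H-38) for `(𝔇 K).Gn` at the table-germ reading
  have h3 := activityReading_termData_of_termwise226 F L 𝔇 (fun K k => sp K (k + 1)) Adm
    (Pot := fun K k => Pot k (sp K)) (fun K k => ρ (sp K) κE (fun j : Fin (k + 1) => aw K k j)) (fun K k => cv κE (fun j : Fin (k + 1) => aw K k j))
    c hL hLc hN (fun K k t ht old hold => hcv K k t ht old hold.1) hT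
  have hcw0 : ∀ K k, (0 : ℝ) ≤ cw := fun K k => (hawpos K k 0).le.trans (hawcw K k 0)
  -- N10 module 105's domination rows at ALL levels; the level-`0` entries of the class vanish
  have hρ₁ : ∀ (K k : ℕ) (o o' : OlderTerms (F.P K) 𝔸 M k), Adm K k o → Adm K k o' → ∀ (B' : ℝ), 0 ≤ B' →
      (∀ (k' : ℕ) (hk' : k' < k) (Y : (domSys (F.P K) M (k' + 1)).Dom), ∀ φ' ∈ sp K (k' + 1) Y,
        aw K k (k' + 1) * (Real.exp (κE * (domSys (F.P K) M (k' + 1)).dj Y) * ‖o ⟨k' + 1, Nat.succ_lt_succ hk'⟩ Y φ' - o' ⟨k' + 1, Nat.succ_lt_succ hk'⟩ Y φ'‖) ≤ B') →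
      ‖ρ (sp K) κE (fun j : Fin (k + 1) => aw K k j) o - ρ (sp K) κE (fun j : Fin (k + 1) => aw K k j) o'‖ ≤ B' := fun K k o o' ho ho' B' hB' h =>
    norm_ρ_sub_ρ_le κE (fun j : Fin (k + 1) => aw K k j) (hsp K) hκr hE₀ (fun j => (hawpos K k j).le) (fun j => hawcw K k j) ho.1 ho'.1 hB'
      fun j Y ψ hψ => by
        rcases Fin.eq_zero_or_eq_succ j with rfl | ⟨j', rfl⟩
        · simpa [ho.2, ho'.2] using hB'
        · exact h j'.1 j'.2 Y ψ hψ
  have hρ₂ : ∀ (K k : ℕ) (o₁ o₂ o₃ : OlderTerms (F.P K) 𝔸 M k), Adm K k o₁ → Adm K k o₂ → Adm K k o₃ → ∀ (B' : ℝ), 0 ≤ B' →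
      (∀ (k' : ℕ) (hk' : k' < k) (Y : (domSys (F.P K) M (k' + 1)).Dom), ∀ φ' ∈ sp K (k' + 1) Y,
        aw K k (k' + 1) * (Real.exp (κE * (domSys (F.P K) M (k' + 1)).dj Y) *
          ‖o₁ ⟨k' + 1, Nat.succ_lt_succ hk'⟩ Y φ' - 2 * o₂ ⟨k' + 1, Nat.succ_lt_succ hk'⟩ Y φ' + o₃ ⟨k' + 1, Nat.succ_lt_succ hk'⟩ Y φ'‖) ≤ B') →
      ‖ρ (sp K) κE (fun j : Fin (k + 1) => aw K k j) o₁ - (2 : ℂ) • ρ (sp K) κE (fun j : Fin (k + 1) => aw K k j) o₂ +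
        ρ (sp K) κE (fun j : Fin (k + 1) => aw K k j) o₃‖ ≤ B' := fun K k o₁ o₂ o₃ h₁ h₂ h₃ B' hB' h =>
    norm_ρ_threePoint_le κE (fun j : Fin (k + 1) => aw K k j) (hsp K) hκr hE₀ (fun j => (hawpos K k j).le) (fun j => hawcw K k j) h₁.1 h₂.1 h₃.1 hB'
      fun j Y ψ hψ => by
        rcases Fin.eq_zero_or_eq_succ j with rfl | ⟨j', rfl⟩
        · simpa [h₁.2, h₂.2, h₃.2] using hB'
        · exact h j'.1 j'.2 Y ψ hψ
  exact ne9_EA_objectsOfRecord₁₃_of_kernelStepRate_activityReadingNonexpansive F N θ ℓ hs hγ hlim hC₅ h5 m' M hM (fun K => (𝔇 K).Gn) emb hloc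
    (fun K k => sp K (k + 1)) hκ₀ hδ₀ hB₃ hr hκE Adm hAdm
    (Pot := fun K k => Pot k (sp K)) (fun K k => ρ (sp K) κE (fun j : Fin (k + 1) => aw K k j))
    (fun K k t φ (Z : (domSys (F.P K) M (k + 1)).Dom) (p : Pot k (sp K)) =>
      ∑ s ∈ terms L M Z, (𝔇 K k).TF Z s ((t : ℝ) : ℂ) (cv κE (fun j : Fin (k + 1) => aw K k j) p) φ)
    h3.1 h3.2.1 h3.2.2 hA0 hr₁ hrate hsmall hκr hrenew
    (fun K k old hold => norm_ρ_le_of_admHist κE (fun j : Fin (k + 1) => aw K k j) (hsp K) hκr hE₀ (fun j => (hawpos K k j).le)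
      (fun j => hawcw K k j) (hcw0 K k) hold.1)
    hρ₁ hρ₂ (fun K k j => (hawpos K k j).le) hawcw hC1 hMb0 hϱ hR O V hcS hBq hballS hholS hbdS Ec ι Φ U hU hrU hEhol hΦemb hΦsp w hw₀ hw htail hκ₅ hω hθω hℓκ hC₉

/-! ## §2 ★★★ The same with the reading section (`hcv`) DISCHARGED from def-W1's laws by N10 module 106 -/

open Classical Finset in
/-- ★★★ **THE SAME WITH THE READING SECTION DISCHARGED FROM def-W1's LAWS (N10 106 `𝒱_tableGerms_reading`)**: per torus and step the unscaled-field law of the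
term-datum family on `]0, γ]` ([I] (2.9)–(2.13): boxes, large-field function, Wilson remainder × `s⁻²` and older-terms potential read at `s·B`), the older-terms potential
READ BY atoms `Rd K k Z t` over parameter spaces `S K k` ([II] (1.41)), the atoms mapping the tables into the tables on configuration windows `W K k Z t` containing the
table `sp K (k+1) X` of every `X ⊇ Z` — then Lemma 2's potentials of `cv (ρ old)` and `old` agree for every admissible `old` (print's (1.41) reads the history through its
values on the small-field tables), and §1 applies.  Older-term input left: `hT` per term + the laws.  LOCATED (hypothesis form); N22 NOT discharged. [folklore] -/
theorem ne9_EA_objectsOfRecord₁₃_of_kernelStepRate_termDataTableGermsLawsNonexpansive (θ : Stage13Params F N) (ℓ : U3Letters₁₁) (hs : ℓ.Signs) (hγ : 0 < θ.γ)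
    (hlim : PolLimitsExistOfRecord₁₃ F N θ) {κ₅ C₅ : ℝ} (hC₅ : 0 ≤ C₅) (h5 : KernelStepRateOfRecord₁₃ F N θ κ₅ ℓ.θ₅ C₅)
    (m' : ℕ) (M : ℕ) [NeZero M] (hM : M = F.L ^ m')
    {c₀ : B13.Consts} {L : ℕ} [NeZero L] (𝔇 : (K : ℕ) → TermData214 c₀ (F.P K) 𝔸 M L) (emb : ReadingMaps F (MatA N) 𝔸)
    (hloc : Localizes17OfRecord₁₃ F N θ (fun K => truncRun K (toClusterTower (𝔇 K).Gn)) emb)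
    (sp : (K j : ℕ) → (domSys (F.P K) M j).Dom → Set (CPair (F.P K) 𝔸))
    (hsp : ∀ (K j : ℕ) (Y : (domSys (F.P K) M j).Dom), IsOpen (sp K j Y))
    {κ κE δ₀ B₃ r R E₀ ϱ Mb cw cS Bq r₁ : ℝ} {aw : ℕ → ℕ → ℕ → ℝ}
    (hκ₀ : kappa₀ (4 * 2 ^ 4) (2 * 4) ≤ κ / 2) (hδ₀ : 0 < δ₀) (hB₃ : 0 ≤ B₃) (hr : 0 < r) (hκE : κ ≤ κE) (hE₀ : 0 ≤ E₀)
    {D : ℕ → Set ℂ} (hRA : ∀ K, RecAdmissible (𝔇 K).Gn (D K) (AdmHist (sp K) E₀ r₁))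
    (hD : ∀ K, ∀ t ∈ Ioc (0 : ℝ) θ.γ, ((t : ℝ) : ℂ) ∈ D K)
    {S : ℕ → ℕ → Type} [∀ K k, MeasurableSpace (S K k)]
    (χu χcu : (K k : ℕ) → (𝔇 K k).UnscaledChi) (𝒲 : (K k : ℕ) → (𝔇 K k).UnscaledWilson) (𝒪 : (K k : ℕ) → (𝔇 K k).UnscaledOlder)
    (Rd : (K k : ℕ) → (Z : (domSys (F.P K) M (k + 1)).Dom) → (t : TermLabel (F.P K) M k L) → (𝔇 K k).ReadingAtoms Z t (S K k))
    (W : (K k : ℕ) → (domSys (F.P K) M (k + 1)).Dom → TermLabel (F.P K) M k L → Set (CPair (F.P K) 𝔸))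
    (hlaw : ∀ K, (𝔇 K).UnscaledFieldLawOn (χu K) (χcu K) (𝒲 K) (𝒪 K) θ.γ) (hread : ∀ K k, (𝔇 K k).ReadsBy (𝒪 K k) (Rd K k))
    (hmaps : ∀ (K k : ℕ) (Z : (domSys (F.P K) M (k + 1)).Dom) (t : TermLabel (F.P K) M k L), (Rd K k Z t).MapsToTables (sp K) (W K k Z t) univ)
    (hW : ∀ (K k : ℕ) (X Z : (domSys (F.P K) M (k + 1)).Dom), Subtype.val Z ⊆ Subtype.val X → ∀ s ∈ terms L M Z, sp K (k + 1) X ⊆ W K k Z s)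
    (c : B13.Consts) (hL : 8 ≤ c.L) (hLc : c.L = L) {a a₂ a₂' a₅ Aabs : ℝ} (hN : Lemma3Numerics c M ((c.L : ℝ) / 2) a a₂ a₂' a₅ Aabs)
    (hT : ∀ (K k : ℕ), ∀ t ∈ Ioc (0 : ℝ) θ.γ, ∀ (X : (domSys (F.P K) M (k + 1)).Dom), ∀ φ ∈ sp K (k + 1) X,
      ∀ Z : (domSys (F.P K) M (k + 1)).Dom, Subtype.val Z ⊆ Subtype.val X → ∀ s ∈ terms L M Z,
        DifferentiableOn ℂ (fun p : Pot k (sp K) => (𝔇 K k).TF Z s ((t : ℝ) : ℂ) (cv κE (fun j : Fin (k + 1) => aw K k j) p) φ) (ball 0 R) ∧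
          ∀ p ∈ ball (0 : Pot k (sp K)) R,
            ‖(𝔇 K k).TF Z s ((t : ℝ) : ℂ) (cv κE (fun j : Fin (k + 1) => aw K k j) p) φ‖ ≤ weight L M c Z a s * Real.exp (a₅ * ((Z.1).card : ℝ)))
    (hA0 : 0 ≤ c.C3act * c.ε₁) (hr₁ : 0 ≤ r₁) (hrate : r₁ + 2 * (64 * Real.log 162) + 2 ≤ (1 - 8 * c.δ) * ((c.L : ℝ) / 2) * c.κ)
    (hsmall : c.C3act * c.ε₁ * Real.exp (5 * r₁ + 1) * K₀ 64 8 * 9 * 64 ≤ 1) (hκr : κE ≤ r₁) (hrenew : Real.exp 1 * 9 * 64 * K₀ 64 8 ^ 2 * (c.C3act * c.ε₁) ≤ Mb)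
    (hawpos : ∀ K k j, 0 < aw K k j) (hawcw : ∀ K k j, aw K k j ≤ cw) (hC1 : 4 * Mb * cw / ϱ < 1)
    (hMb0 : 0 ≤ Mb) (hϱ : 0 < ϱ) (hR : cw * E₀ + ϱ < R)
    (O : ℕ → Set ℂ) (V : (K k : ℕ) → OlderTerms (F.P K) 𝔸 M k → CPair (F.P K) 𝔸 → (domSys (F.P K) M (k + 1)).Dom → ℂ) (hcS : 0 < cS) (hBq : 0 ≤ Bq)
    (hballS : ∀ K, ∀ s ∈ Ioc (0 : ℝ) θ.γ, closedBall (s : ℂ) (cS * s) ⊆ O K)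
    (hholS : ∀ (K k : ℕ) (old : OlderTerms (F.P K) 𝔸 M k), old ∈ AdmHist (sp K) E₀ r₁ k ∧ old 0 = 0 → ∀ (X : (domSys (F.P K) M (k + 1)).Dom), ∀ φ ∈ sp K (k + 1) X,
      DifferentiableOn ℂ (fun z => ((𝔇 K).Gn k).E z old φ X) (O K))
    (hbdS : ∀ (K k : ℕ) (old : OlderTerms (F.P K) 𝔸 M k), old ∈ AdmHist (sp K) E₀ r₁ k ∧ old 0 = 0 → ∀ (X : (domSys (F.P K) M (k + 1)).Dom), ∀ φ ∈ sp K (k + 1) X,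
      ∀ s ∈ Ioc (0 : ℝ) θ.γ, ∀ z ∈ closedBall (s : ℂ) (cS * s),
        ‖((𝔇 K).Gn k).E z old φ X - V K k old φ X‖ ≤ Bq * Real.exp (-(κE * (domSys (F.P K) M (k + 1)).dj X)) * s ^ 2)
    (Ec : ℕ → ℕ → Type*) [∀ K k, NormedAddCommGroup (Ec K k)] [∀ K k, NormedSpace ℂ (Ec K k)]
    (ι : letI := θ.instVβ₁; letI := θ.instVβ₂
      (K k : ℕ) → (domSys (F.P K) M (k + 1)).Dom → ((Fin (F.P K).d → Site (F.P K) (k + 1) → θ.Vβ) →L[ℝ] Ec K k))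
    (Φ : (K k : ℕ) → (domSys (F.P K) M (k + 1)).Dom → Ec K k → CPair (F.P K) 𝔸)
    (U : (K k : ℕ) → (domSys (F.P K) M (k + 1)).Dom → Set (Ec K k)) (hU : ∀ K k X, IsOpen (U K k X)) (hrU : ∀ K k X, ball (0 : Ec K k) r ⊆ U K k X)
    (hEhol : ∀ g ∈ Window θ.γ, ∀ (K k : ℕ) (X : (domSys (F.P K) M (k + 1)).Dom),
      DifferentiableOn ℂ (fun z => (truncRun K (toClusterTower (𝔇 K).Gn) k).E (histPrefix g k) (Φ K k X z) X) (U K k X))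
    (hΦemb : letI := θ.instVβ₁; letI := θ.instVβ₂
      ∀ (K k : ℕ) (X : (domSys (F.P K) M (k + 1)).Dom) (Bf : Fin (F.P K).d → Site (F.P K) (k + 1) → θ.Vβ),
        Φ K k X (ι K k X Bf) = emb K k (fun l t => NormedSpace.exp (θ.ρ8 (Bf l t))))
    (hΦsp : ∀ (K k : ℕ) (X : (domSys (F.P K) M (k + 1)).Dom), ∀ z ∈ ball (0 : Ec K k) r, Φ K k X z ∈ sp K (k + 1) X)
    (w : (K k : ℕ) → (domSys (F.P K) M (k + 1)).Dom → Site (F.P K) (k + 1) → ℝ) (hw₀ : ∀ K k X t, 0 ≤ w K k X t)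
    (hw : letI := θ.instVβ₁; letI := θ.instVβ₂; letI := θ.instιβ
      ∀ (K k : ℕ) (X : (domSys (F.P K) M (k + 1)).Dom) (l : Fin (F.P K).d) (t : Site (F.P K) (k + 1)) (c : θ.ιβ),
        ‖ι K k X (Pi.single l (Pi.single t (θ.bV c)))‖ ≤ w K k X t)
    (htail : ∀ (K k : ℕ) (X : (domSys (F.P K) M (k + 1)).Dom) (t : Site (F.P K) (k + 1)),
      let e : Site (F.P K) (k + 1) → TPt 4 (domCount (F.P K) M (k + 1) * M) := fun x i => (ZMod.cast (x i) : ZMod (domCount (F.P K) M (k + 1) * M))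
      w K k X t ≤ B₃ * Real.exp (-δ₀ * distCT (domCount (F.P K) M (k + 1)) M (e t) (nearT (M := M) (e t) X)))
    (hκ₅ : delta1 δ₀ κ ((M : ℝ) * 4) ≤ κ₅)
    (hω : 0 < ℓ.ω) (hθω : ℓ.θ₅ ≤ ℓ.ω ^ 2) (hℓκ : ℓ.κ ≤ delta1 δ₀ κ ((M : ℝ) * 4))
    (hC₉ : (4 * (2 * C₅ / (1 - ℓ.θ₅) + 2 * ((16 * Mb * B₃ ^ 2 / r ^ 2) * Real.exp (delta1 δ₀ κ ((M : ℝ) * 4) * ((M : ℝ) * 4) * 3) * K₀ (4 * 2 ^ 4) (2 * 4) * K₁ 4 (δ₀ / 2))) / θ.γ +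
        ((16 * max ((6 * cS ^ 2 + 32 * cS + 64) / cS ^ 2 * Bq) (64 * Mb * cw ^ 2 / ϱ ^ 2 * (Bq * θ.γ / cS) ^ 2 / (1 - 4 * Mb * cw / ϱ)) * B₃ ^ 2 / r ^ 2) * Real.exp (delta1 δ₀ κ ((M : ℝ) * 4) * ((M : ℝ) * 4) * 3) * K₀ (4 * 2 ^ 4) (2 * 4) *
          K₁ 4 (δ₀ / 2)) * θ.γ / 2) / ℓ.ω ≤ ℓ.C₉) :
    NE9 ((objectsOfRecord₁₃ F N θ ℓ).EA 0) (Window θ.γ) ℓ.κ ℓ.moduli :=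
  ne9_EA_objectsOfRecord₁₃_of_kernelStepRate_termDataTableGermsNonexpansive F N
    θ ℓ hs hγ hlim hC₅ h5 m' M hM 𝔇 emb hloc sp hsp hκ₀ hδ₀ hB₃ hr hκE hE₀ hRA hD
    (fun K k _ ht _ hold X _ hφ Z hZ s hs' Y B => 𝒱_tableGerms_reading (𝔇 K k) (sp K) κE (fun j : Fin (k + 1) => aw K k j) (Rd K k) (W K k)
        (hlaw K k) (hread K k) (hmaps K k) (hsp K) hκr hE₀ (fun j => hawpos K k j) (fun j => hawcw K k j) ht hold (hW K k X Z hZ s hs' hφ) Y B)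
    c hL hLc hN hT hA0 hr₁ hrate hsmall hκr hrenew hawpos hawcw hC1 hMb0 hϱ hR O V hcS hBq hballS hholS hbdS Ec ι Φ U hU hrU hEhol hΦemb hΦsp w hw₀ hw htail hκ₅ hω hθω
    hℓκ hC₉

/-! ## §3 ★★★ The kernel-face socket -/

open Classical Finset in
/-- ★★★ **THE KERNEL-FACE SOCKET FOR def-W1's TERM DATA READ ON N10's TABLE-GERM CARRIER, LAWS EDITION** — §2's inputs ⟹ **`N22At (u3OfRecord₁₃ θ (objectsOfRecord₁₃ F N θ ℓ) k)`
for EVERY run length `k`** (dag-n27-c's `h22` row).  LOCATED (hypothesis form); N22 NOT discharged. [folklore] -/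
theorem n22At_u3OfRecord₁₃_of_kernelStepRate_termDataTableGermsLawsNonexpansive (θ : Stage13Params F N) (ℓ : U3Letters₁₁) (hs : ℓ.Signs) (hγ : 0 < θ.γ)
    (hlim : PolLimitsExistOfRecord₁₃ F N θ) {κ₅ C₅ : ℝ} (hC₅ : 0 ≤ C₅) (h5 : KernelStepRateOfRecord₁₃ F N θ κ₅ ℓ.θ₅ C₅)
    (m' : ℕ) (M : ℕ) [NeZero M] (hM : M = F.L ^ m')
    {c₀ : B13.Consts} {L : ℕ} [NeZero L] (𝔇 : (K : ℕ) → TermData214 c₀ (F.P K) 𝔸 M L) (emb : ReadingMaps F (MatA N) 𝔸)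
    (hloc : Localizes17OfRecord₁₃ F N θ (fun K => truncRun K (toClusterTower (𝔇 K).Gn)) emb)
    (sp : (K j : ℕ) → (domSys (F.P K) M j).Dom → Set (CPair (F.P K) 𝔸))
    (hsp : ∀ (K j : ℕ) (Y : (domSys (F.P K) M j).Dom), IsOpen (sp K j Y))
    {κ κE δ₀ B₃ r R E₀ ϱ Mb cw cS Bq r₁ : ℝ} {aw : ℕ → ℕ → ℕ → ℝ}
    (hκ₀ : kappa₀ (4 * 2 ^ 4) (2 * 4) ≤ κ / 2) (hδ₀ : 0 < δ₀) (hB₃ : 0 ≤ B₃) (hr : 0 < r) (hκE : κ ≤ κE) (hE₀ : 0 ≤ E₀)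
    {D : ℕ → Set ℂ} (hRA : ∀ K, RecAdmissible (𝔇 K).Gn (D K) (AdmHist (sp K) E₀ r₁))
    (hD : ∀ K, ∀ t ∈ Ioc (0 : ℝ) θ.γ, ((t : ℝ) : ℂ) ∈ D K)
    {S : ℕ → ℕ → Type} [∀ K k, MeasurableSpace (S K k)]
    (χu χcu : (K k : ℕ) → (𝔇 K k).UnscaledChi) (𝒲 : (K k : ℕ) → (𝔇 K k).UnscaledWilson) (𝒪 : (K k : ℕ) → (𝔇 K k).UnscaledOlder)
    (Rd : (K k : ℕ) → (Z : (domSys (F.P K) M (k + 1)).Dom) → (t : TermLabel (F.P K) M k L) → (𝔇 K k).ReadingAtoms Z t (S K k))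
    (W : (K k : ℕ) → (domSys (F.P K) M (k + 1)).Dom → TermLabel (F.P K) M k L → Set (CPair (F.P K) 𝔸))
    (hlaw : ∀ K, (𝔇 K).UnscaledFieldLawOn (χu K) (χcu K) (𝒲 K) (𝒪 K) θ.γ) (hread : ∀ K k, (𝔇 K k).ReadsBy (𝒪 K k) (Rd K k))
    (hmaps : ∀ (K k : ℕ) (Z : (domSys (F.P K) M (k + 1)).Dom) (t : TermLabel (F.P K) M k L), (Rd K k Z t).MapsToTables (sp K) (W K k Z t) univ)
    (hW : ∀ (K k : ℕ) (X Z : (domSys (F.P K) M (k + 1)).Dom), Subtype.val Z ⊆ Subtype.val X → ∀ s ∈ terms L M Z, sp K (k + 1) X ⊆ W K k Z s)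
    (c : B13.Consts) (hL : 8 ≤ c.L) (hLc : c.L = L) {a a₂ a₂' a₅ Aabs : ℝ} (hN : Lemma3Numerics c M ((c.L : ℝ) / 2) a a₂ a₂' a₅ Aabs)
    (hT : ∀ (K k : ℕ), ∀ t ∈ Ioc (0 : ℝ) θ.γ, ∀ (X : (domSys (F.P K) M (k + 1)).Dom), ∀ φ ∈ sp K (k + 1) X,
      ∀ Z : (domSys (F.P K) M (k + 1)).Dom, Subtype.val Z ⊆ Subtype.val X → ∀ s ∈ terms L M Z,
        DifferentiableOn ℂ (fun p : Pot k (sp K) => (𝔇 K k).TF Z s ((t : ℝ) : ℂ) (cv κE (fun j : Fin (k + 1) => aw K k j) p) φ) (ball 0 R) ∧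
          ∀ p ∈ ball (0 : Pot k (sp K)) R,
            ‖(𝔇 K k).TF Z s ((t : ℝ) : ℂ) (cv κE (fun j : Fin (k + 1) => aw K k j) p) φ‖ ≤ weight L M c Z a s * Real.exp (a₅ * ((Z.1).card : ℝ)))
    (hA0 : 0 ≤ c.C3act * c.ε₁) (hr₁ : 0 ≤ r₁) (hrate : r₁ + 2 * (64 * Real.log 162) + 2 ≤ (1 - 8 * c.δ) * ((c.L : ℝ) / 2) * c.κ)
    (hsmall : c.C3act * c.ε₁ * Real.exp (5 * r₁ + 1) * K₀ 64 8 * 9 * 64 ≤ 1) (hκr : κE ≤ r₁) (hrenew : Real.exp 1 * 9 * 64 * K₀ 64 8 ^ 2 * (c.C3act * c.ε₁) ≤ Mb)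
    (hawpos : ∀ K k j, 0 < aw K k j) (hawcw : ∀ K k j, aw K k j ≤ cw) (hC1 : 4 * Mb * cw / ϱ < 1)
    (hMb0 : 0 ≤ Mb) (hϱ : 0 < ϱ) (hR : cw * E₀ + ϱ < R)
    (O : ℕ → Set ℂ) (V : (K k : ℕ) → OlderTerms (F.P K) 𝔸 M k → CPair (F.P K) 𝔸 → (domSys (F.P K) M (k + 1)).Dom → ℂ) (hcS : 0 < cS) (hBq : 0 ≤ Bq)
    (hballS : ∀ K, ∀ s ∈ Ioc (0 : ℝ) θ.γ, closedBall (s : ℂ) (cS * s) ⊆ O K)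
    (hholS : ∀ (K k : ℕ) (old : OlderTerms (F.P K) 𝔸 M k), old ∈ AdmHist (sp K) E₀ r₁ k ∧ old 0 = 0 → ∀ (X : (domSys (F.P K) M (k + 1)).Dom), ∀ φ ∈ sp K (k + 1) X,
      DifferentiableOn ℂ (fun z => ((𝔇 K).Gn k).E z old φ X) (O K))
    (hbdS : ∀ (K k : ℕ) (old : OlderTerms (F.P K) 𝔸 M k), old ∈ AdmHist (sp K) E₀ r₁ k ∧ old 0 = 0 → ∀ (X : (domSys (F.P K) M (k + 1)).Dom), ∀ φ ∈ sp K (k + 1) X,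
      ∀ s ∈ Ioc (0 : ℝ) θ.γ, ∀ z ∈ closedBall (s : ℂ) (cS * s),
        ‖((𝔇 K).Gn k).E z old φ X - V K k old φ X‖ ≤ Bq * Real.exp (-(κE * (domSys (F.P K) M (k + 1)).dj X)) * s ^ 2)
    (Ec : ℕ → ℕ → Type*) [∀ K k, NormedAddCommGroup (Ec K k)] [∀ K k, NormedSpace ℂ (Ec K k)]
    (ι : letI := θ.instVβ₁; letI := θ.instVβ₂
      (K k : ℕ) → (domSys (F.P K) M (k + 1)).Dom → ((Fin (F.P K).d → Site (F.P K) (k + 1) → θ.Vβ) →L[ℝ] Ec K k))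
    (Φ : (K k : ℕ) → (domSys (F.P K) M (k + 1)).Dom → Ec K k → CPair (F.P K) 𝔸)
    (U : (K k : ℕ) → (domSys (F.P K) M (k + 1)).Dom → Set (Ec K k)) (hU : ∀ K k X, IsOpen (U K k X)) (hrU : ∀ K k X, ball (0 : Ec K k) r ⊆ U K k X)
    (hEhol : ∀ g ∈ Window θ.γ, ∀ (K k : ℕ) (X : (domSys (F.P K) M (k + 1)).Dom),
      DifferentiableOn ℂ (fun z => (truncRun K (toClusterTower (𝔇 K).Gn) k).E (histPrefix g k) (Φ K k X z) X) (U K k X))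
    (hΦemb : letI := θ.instVβ₁; letI := θ.instVβ₂
      ∀ (K k : ℕ) (X : (domSys (F.P K) M (k + 1)).Dom) (Bf : Fin (F.P K).d → Site (F.P K) (k + 1) → θ.Vβ),
        Φ K k X (ι K k X Bf) = emb K k (fun l t => NormedSpace.exp (θ.ρ8 (Bf l t))))
    (hΦsp : ∀ (K k : ℕ) (X : (domSys (F.P K) M (k + 1)).Dom), ∀ z ∈ ball (0 : Ec K k) r, Φ K k X z ∈ sp K (k + 1) X)
    (w : (K k : ℕ) → (domSys (F.P K) M (k + 1)).Dom → Site (F.P K) (k + 1) → ℝ) (hw₀ : ∀ K k X t, 0 ≤ w K k X t)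
    (hw : letI := θ.instVβ₁; letI := θ.instVβ₂; letI := θ.instιβ
      ∀ (K k : ℕ) (X : (domSys (F.P K) M (k + 1)).Dom) (l : Fin (F.P K).d) (t : Site (F.P K) (k + 1)) (c : θ.ιβ),
        ‖ι K k X (Pi.single l (Pi.single t (θ.bV c)))‖ ≤ w K k X t)
    (htail : ∀ (K k : ℕ) (X : (domSys (F.P K) M (k + 1)).Dom) (t : Site (F.P K) (k + 1)),
      let e : Site (F.P K) (k + 1) → TPt 4 (domCount (F.P K) M (k + 1) * M) := fun x i => (ZMod.cast (x i) : ZMod (domCount (F.P K) M (k + 1) * M))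
      w K k X t ≤ B₃ * Real.exp (-δ₀ * distCT (domCount (F.P K) M (k + 1)) M (e t) (nearT (M := M) (e t) X)))
    (hκ₅ : delta1 δ₀ κ ((M : ℝ) * 4) ≤ κ₅)
    (hω : 0 < ℓ.ω) (hθω : ℓ.θ₅ ≤ ℓ.ω ^ 2) (hℓκ : ℓ.κ ≤ delta1 δ₀ κ ((M : ℝ) * 4))
    (hC₉ : (4 * (2 * C₅ / (1 - ℓ.θ₅) + 2 * ((16 * Mb * B₃ ^ 2 / r ^ 2) * Real.exp (delta1 δ₀ κ ((M : ℝ) * 4) * ((M : ℝ) * 4) * 3) * K₀ (4 * 2 ^ 4) (2 * 4) * K₁ 4 (δ₀ / 2))) / θ.γ +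
        ((16 * max ((6 * cS ^ 2 + 32 * cS + 64) / cS ^ 2 * Bq) (64 * Mb * cw ^ 2 / ϱ ^ 2 * (Bq * θ.γ / cS) ^ 2 / (1 - 4 * Mb * cw / ϱ)) * B₃ ^ 2 / r ^ 2) * Real.exp (delta1 δ₀ κ ((M : ℝ) * 4) * ((M : ℝ) * 4) * 3) * K₀ (4 * 2 ^ 4) (2 * 4) *
          K₁ 4 (δ₀ / 2)) * θ.γ / 2) / ℓ.ω ≤ ℓ.C₉) (k : ℕ) :
    N22At (u3OfRecord₁₃ θ (objectsOfRecord₁₃ F N θ ℓ) k) :=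
  (n22At_u3OfRecord₁₃_objectsOfRecord₁₃_iff F N θ ℓ hs k).2
    (ne9_EA_objectsOfRecord₁₃_of_kernelStepRate_termDataTableGermsLawsNonexpansive F N
      θ ℓ hs hγ hlim hC₅ h5 m' M hM 𝔇 emb hloc sp hsp hκ₀ hδ₀ hB₃ hr hκE hE₀ hRA hD χu χcu 𝒲 𝒪 Rd W hlaw hread hmaps hW c hL hLc hN hT hA0 hr₁ hrate hsmall hκr
      hrenew hawpos hawcw hC1 hMb0 hϱ hR O V hcS hBq hballS hholS hbdS Ec ι Φ U hU hrU hEhol hΦemb hΦsp w hw₀ hw htail hκ₅ hω hθω hℓκ hC₉)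

end YMDAG.N22.KernelFading

end
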